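import Summits.AtomisticToContinuum.Crystallization.Theorems.MinimisingLawsHaveAtoms.Negative.FirstShellRadius
import Summits.AtomisticToContinuum.Crystallization.Theorems.PalmUnimodularRigidityBenjaminiSchrammLimitEmbedding

/-!
# Negative knowledge for crux `MinimisingLawsHaveAtoms` (stmt-AtomisticToContinuum-15776), XII:
# the randomly dilated law charges no rooted isometry class

Standing crux disprover `cdisprove-stmt-AtomisticToContinuum-15776`,
`--supports stmt-AtomisticToContinuum-15776`; seventh piece of the threshold-sharpness programme.

`dilatedLaw_rootedClass_eq_zero`: for a probability law `Q` on rooted `δ`-hard-core configurations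
giving mass `0` to the one-point configuration, and an atomless dilation law `ν` with `ν(−∞, 1] = 0`,
the randomly dilated law (push-forward of `ν ⊗ Q` along `(c, S) ↦ count|((max c 1) • S)`) gives
(outer) measure `0` to EVERY rooted isometry class `{count|A(Y − q)}`.  Proof: the class is
contained in the Borel set where the first-shell radius (Part XI) takes a value in the countable set
`{⊤} ∪ {ofReal (inf dist(Y ∖ q, q)) : q ∈ Y}`; along the dilation the radius is multiplied by
`max c 1`, so every `S`-section of the preimage is contained in `(−∞, 1] ∪ (countable set)`, which is
`ν`-null, and Fubini (`Measure.prod_apply_symm`) concludes; the one-point configurations (radius `⊤`,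
fixed by dilations) are `Q`-null by hypothesis (for minimising laws: Part VII).  All `[folklore]`.
-/

noncomputable section

namespace Summit.AtomisticToContinuum.Crystallization.Theorems.MinimisingLawsHaveAtoms.Negative.DilatedLawDiffuse

open MeasureTheory Set Filter Metric Function
open scoped ENNReal Topology
open Literature.MathematicalPhysics.StatisticalMechanics Literature.Probability.Process
open Literature.Probability.Process.LocalConfig
open Summit.AtomisticToContinuum.Crystallization.Theorems.BenjaminiSchrammLimit
  (measurableEmbedding_toMeasure)
open Summit.AtomisticToContinuum.Crystallization.Theorems.MinimisingLawsHaveAtoms.Negative.DilationFamily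
open Summit.AtomisticToContinuum.Crystallization.Theorems.MinimisingLawsHaveAtoms.Negative.FirstShellRadius

/-- **Level sets of the dilated radius are `ν`-null**: for `0 < r < ⊤`, an atomless `ν` with
`ν(−∞, 1] = 0` gives mass `0` to `{c | ofReal (max c 1) · r = v}`. [folklore] -/
theorem measure_setOf_ofReal_max_mul_eq (ν : Measure ℝ) [NullSingletonClass ν] (hν1 : ν (Iic 1) = 0)
    {r : ℝ≥0∞} (hr0 : r ≠ 0) (hrt : r ≠ ⊤) (v : ℝ≥0∞) :
    ν {c : ℝ | ENNReal.ofReal (max c 1) * r = v} = 0 := by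
  have hsub : {c : ℝ | ENNReal.ofReal (max c 1) * r = v} ⊆ Iic 1 ∪ {(v / r).toReal} := by
    intro c hc
    rw [mem_setOf_eq] at hc
    by_cases hc1 : c ≤ 1
    · exact Or.inl hc1
    · right
      rw [mem_singleton_iff]
      rw [not_le] at hc1
      have hmax : max c 1 = c := max_eq_left hc1.le
      rw [hmax] at hc
      have h1 : ENNReal.ofReal c = v / r := by
        rw [ENNReal.eq_div_iff hr0 hrt, mul_comm]
        exact hc
      rw [← h1, ENNReal.toReal_ofReal (by linarith)]
  refine measure_mono_null hsub ?_
  rw [measure_union_null_iff]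
  exact ⟨hν1, measure_singleton _⟩

variable {δ : ℝ} [Fact (0 < δ)]

/-- **The randomly dilated law charges no rooted isometry class.** [folklore] -/
theorem dilatedLaw_rootedClass_eq_zero
    (Q : Measure (RootedHardCoreConfig (EuclideanSpace ℝ (Fin 3)) δ)) [IsProbabilityMeasure Q]
    (ν : Measure ℝ) [IsProbabilityMeasure ν] [NullSingletonClass ν] (hν1 : ν (Iic 1) = 0)
    (hQ1 : Q {S : RootedHardCoreConfig (EuclideanSpace ℝ (Fin 3)) δ |
      ((S.1 : LocalConfig (EuclideanSpace ℝ (Fin 3))) : Set (EuclideanSpace ℝ (Fin 3))) = {0}} = 0)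
    (Y : Set (EuclideanSpace ℝ (Fin 3))) :
    (((ν.prod Q).map fun p : ℝ × RootedHardCoreConfig (EuclideanSpace ℝ (Fin 3)) δ =>
      (⟨LocalConfig.mk ((fun x : EuclideanSpace ℝ (Fin 3) => max p.1 1 • x) ''
          ((p.2.1 : LocalConfig (EuclideanSpace ℝ (Fin 3))) : Set (EuclideanSpace ℝ (Fin 3)))),
        smul_image_rooted_separated (le_max_right _ _) p.2.2.1 p.2.2.2⟩ :
          RootedHardCoreConfig (EuclideanSpace ℝ (Fin 3)) δ)).map
      (fun S : RootedHardCoreConfig (EuclideanSpace ℝ (Fin 3)) δ =>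
        (S.1 : LocalConfig (EuclideanSpace ℝ (Fin 3))).toMeasure))
      {μ : Measure (EuclideanSpace ℝ (Fin 3)) | ∃ A : EuclideanSpace ℝ (Fin 3) →ₗᵢ[ℝ]
        EuclideanSpace ℝ (Fin 3), ∃ q ∈ Y, μ = (Measure.count : Measure
          (EuclideanSpace ℝ (Fin 3))).restrict ((fun s => A (s - q)) '' Y)} = 0 := by
  have hδ : 0 < δ := Fact.out
  have hE := measurableEmbedding_toMeasure (EuclideanSpace ℝ (Fin 3)) (δ := δ)
  have hΨ := measurable_dilate (δ := δ)
  rw [hE.map_apply]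
  -- the preimage `W` of the class on the configuration space
  set W : Set (RootedHardCoreConfig (EuclideanSpace ℝ (Fin 3)) δ) :=
    (fun S : RootedHardCoreConfig (EuclideanSpace ℝ (Fin 3)) δ =>
      (S.1 : LocalConfig (EuclideanSpace ℝ (Fin 3))).toMeasure) ⁻¹'
      {μ : Measure (EuclideanSpace ℝ (Fin 3)) | ∃ A : EuclideanSpace ℝ (Fin 3) →ₗᵢ[ℝ]
        EuclideanSpace ℝ (Fin 3), ∃ q ∈ Y, μ = (Measure.count : Measure
          (EuclideanSpace ℝ (Fin 3))).restrict ((fun s => A (s - q)) '' Y)} with hWdef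
  by_cases hW : W = ∅
  · rw [hW, measure_empty]
  obtain ⟨S₀, hS₀⟩ := Set.nonempty_iff_ne_empty.2 hW
  have hYc : Y.Countable := countable_of_mem_rootedClass hδ S₀ hS₀
  -- the first-shell radius and its admissible values on the class
  set ρ : RootedHardCoreConfig (EuclideanSpace ℝ (Fin 3)) δ → ℝ≥0∞ := fun S =>
    ⨆ (q : ℚ) (_ : ((S.1 : LocalConfig (EuclideanSpace ℝ (Fin 3))).toMeasure) (closedBall 0 q) ≤ 1),
      ENNReal.ofReal (q : ℝ) with hρdef
  have hρ : Measurable ρ := measurable_firstShell hδ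
  set R : Set ℝ≥0∞ := insert ⊤ ((fun q : EuclideanSpace ℝ (Fin 3) =>
    ENNReal.ofReal (sInf {r : ℝ | ∃ y ∈ Y, y ≠ q ∧ r = dist y q})) '' Y) with hRdef
  have hRc : R.Countable := (hYc.image _).insert _
  have hRm : MeasurableSet R := hRc.measurableSet
  have hWsub : W ⊆ ρ ⁻¹' R := fun S hS => by
    rcases firstShell_mem_of_mem_rootedClass S hS with htop | ⟨q, hq, hval⟩
    · rw [mem_preimage]
      simp only [hρdef] at htop ⊢
      rw [htop]
      exact mem_insert ⊤ _
    · rw [mem_preimage]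
      simp only [hρdef] at hval ⊢
      rw [hval]
      exact mem_insert_of_mem _ ⟨q, hq, rfl⟩
  -- the one-point configurations and their complement
  set Tinf : Set (RootedHardCoreConfig (EuclideanSpace ℝ (Fin 3)) δ) := ρ ⁻¹' {⊤} with hTinf
  have hTinf_m : MeasurableSet Tinf := hρ (measurableSet_singleton ⊤)
  have hTinf0 : Q Tinf = 0 := by
    refine measure_mono_null (fun S hS => ?_) hQ1
    exact (firstShell_eq_top_iff S).1 hS
  -- the good part of the preimage of `ρ ⁻¹' R` under the dilation
  set G' : Set (ℝ × RootedHardCoreConfig (EuclideanSpace ℝ (Fin 3)) δ) :=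
    {p | ρ p.2 ≠ ⊤ ∧ ENNReal.ofReal (max p.1 1) * ρ p.2 ∈ R} with hG'def
  have hfun : Measurable fun p : ℝ × RootedHardCoreConfig (EuclideanSpace ℝ (Fin 3)) δ =>
      ENNReal.ofReal (max p.1 1) * ρ p.2 :=
    (ENNReal.measurable_ofReal.comp (measurable_fst.max measurable_const)).mul (hρ.comp measurable_snd)
  have hG'm : MeasurableSet G' :=
    ((hρ.comp measurable_snd) (measurableSet_singleton ⊤)).compl.inter (hfun hRm)
  -- the preimage of `ρ ⁻¹' R ⊇ W` under the dilation sits inside `(univ ×ˢ Tinf) ∪ G'`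
  have hincl : (fun p : ℝ × RootedHardCoreConfig (EuclideanSpace ℝ (Fin 3)) δ =>
      (⟨LocalConfig.mk ((fun x : EuclideanSpace ℝ (Fin 3) => max p.1 1 • x) ''
          ((p.2.1 : LocalConfig (EuclideanSpace ℝ (Fin 3))) : Set (EuclideanSpace ℝ (Fin 3)))),
        smul_image_rooted_separated (le_max_right _ _) p.2.2.1 p.2.2.2⟩ :
          RootedHardCoreConfig (EuclideanSpace ℝ (Fin 3)) δ)) ⁻¹' (ρ ⁻¹' R) ⊆ (univ ×ˢ Tinf) ∪ G' := by
    intro p hp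
    have hR : ρ (⟨LocalConfig.mk ((fun x : EuclideanSpace ℝ (Fin 3) => max p.1 1 • x) ''
          ((p.2.1 : LocalConfig (EuclideanSpace ℝ (Fin 3))) : Set (EuclideanSpace ℝ (Fin 3)))),
        smul_image_rooted_separated (le_max_right _ _) p.2.2.1 p.2.2.2⟩ :
          RootedHardCoreConfig (EuclideanSpace ℝ (Fin 3)) δ) ∈ R := hp
    have hdil := firstShell_dilate p.1 p.2 (⟨LocalConfig.mk ((fun x : EuclideanSpace ℝ (Fin 3) =>
      max p.1 1 • x) '' ((p.2.1 : LocalConfig (EuclideanSpace ℝ (Fin 3))) :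
        Set (EuclideanSpace ℝ (Fin 3)))), smul_image_rooted_separated (le_max_right _ _)
          p.2.2.1 p.2.2.2⟩ : RootedHardCoreConfig (EuclideanSpace ℝ (Fin 3)) δ) rfl
    simp only [hρdef] at hR hdil ⊢
    rw [hdil] at hR
    by_cases htop : (⨆ (q : ℚ) (_ : ((p.2.1 : LocalConfig (EuclideanSpace ℝ (Fin 3))).toMeasure)
        (closedBall 0 q) ≤ 1), ENNReal.ofReal (q : ℝ)) = ⊤
    · exact Or.inl ⟨mem_univ _, htop⟩
    · exact Or.inr ⟨htop, hR⟩
  -- measure bookkeeping: `W ⊆ ρ ⁻¹' R` (Borel), whose preimage under the dilation is null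
  have hnull : (ν.prod Q) ((univ ×ˢ Tinf) ∪ G') = 0 := by
    rw [measure_union_null_iff]
    refine ⟨?_, ?_⟩
    · rw [Measure.prod_prod, hTinf0, mul_zero]
    · rw [Measure.prod_apply_symm hG'm]
      refine (lintegral_congr fun S => ?_).trans lintegral_zero
      change ν {c : ℝ | ρ S ≠ ⊤ ∧ ENNReal.ofReal (max c 1) * ρ S ∈ R} = 0
      by_cases hS : ρ S = ⊤
      · have : {c : ℝ | ρ S ≠ ⊤ ∧ ENNReal.ofReal (max c 1) * ρ S ∈ R} = ∅ :=
          Set.eq_empty_of_forall_notMem fun c hc => hc.1 hS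
        rw [this, measure_empty]
      · -- `0 < ρ S < ⊤`: every level set of the dilated radius is `ν`-null
        have hS0 : ρ S ≠ 0 := by
          have hne : ((S.1 : LocalConfig (EuclideanSpace ℝ (Fin 3))) : Set (EuclideanSpace ℝ (Fin 3))) ≠ {0} :=
            fun h => hS ((firstShell_eq_top_iff S).2 h)
          have hex : ∃ z ∈ ((S.1 : LocalConfig (EuclideanSpace ℝ (Fin 3))) : Set (EuclideanSpace ℝ (Fin 3))),
              z ≠ 0 := by
            by_contra hno
            push Not at hno
            exact hne (Set.eq_singleton_iff_unique_mem.2 ⟨S.2.1, hno⟩)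
          simp only [hρdef]
          rw [firstShell_eq_ofReal_sInf S hex, ne_eq, ENNReal.ofReal_eq_zero, not_le]
          refine lt_of_lt_of_le hδ (le_csInf ?_ fun r hr => ?_)
          · obtain ⟨z, hz, hz0⟩ := hex
            exact ⟨‖z‖, z, hz, hz0, rfl⟩
          · obtain ⟨z, hz, hz0, rfl⟩ := hr
            have := S.2.2 z hz 0 S.2.1 hz0
            rwa [dist_zero_right] at this
        have hsub : {c : ℝ | ρ S ≠ ⊤ ∧ ENNReal.ofReal (max c 1) * ρ S ∈ R} ⊆
            ⋃ v ∈ R, {c : ℝ | ENNReal.ofReal (max c 1) * ρ S = v} := fun c hc =>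
          mem_biUnion hc.2 rfl
        refine measure_mono_null hsub ?_
        rw [measure_biUnion_null_iff hRc]
        exact fun v _ => measure_setOf_ofReal_max_mul_eq ν hν1 hS0 hS v
  refine le_antisymm ?_ bot_le
  calc ((ν.prod Q).map fun p : ℝ × RootedHardCoreConfig (EuclideanSpace ℝ (Fin 3)) δ =>
        (⟨LocalConfig.mk ((fun x : EuclideanSpace ℝ (Fin 3) => max p.1 1 • x) ''
            ((p.2.1 : LocalConfig (EuclideanSpace ℝ (Fin 3))) : Set (EuclideanSpace ℝ (Fin 3)))),
          smul_image_rooted_separated (le_max_right _ _) p.2.2.1 p.2.2.2⟩ :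
            RootedHardCoreConfig (EuclideanSpace ℝ (Fin 3)) δ)) W
      ≤ ((ν.prod Q).map fun p : ℝ × RootedHardCoreConfig (EuclideanSpace ℝ (Fin 3)) δ =>
        (⟨LocalConfig.mk ((fun x : EuclideanSpace ℝ (Fin 3) => max p.1 1 • x) ''
            ((p.2.1 : LocalConfig (EuclideanSpace ℝ (Fin 3))) : Set (EuclideanSpace ℝ (Fin 3)))),
          smul_image_rooted_separated (le_max_right _ _) p.2.2.1 p.2.2.2⟩ :
            RootedHardCoreConfig (EuclideanSpace ℝ (Fin 3)) δ)) (ρ ⁻¹' R) := measure_mono hWsub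
    _ = (ν.prod Q) ((fun p : ℝ × RootedHardCoreConfig (EuclideanSpace ℝ (Fin 3)) δ =>
        (⟨LocalConfig.mk ((fun x : EuclideanSpace ℝ (Fin 3) => max p.1 1 • x) ''
            ((p.2.1 : LocalConfig (EuclideanSpace ℝ (Fin 3))) : Set (EuclideanSpace ℝ (Fin 3)))),
          smul_image_rooted_separated (le_max_right _ _) p.2.2.1 p.2.2.2⟩ :
            RootedHardCoreConfig (EuclideanSpace ℝ (Fin 3)) δ)) ⁻¹' (ρ ⁻¹' R)) :=
        Measure.map_apply hΨ (hρ hRm)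
    _ ≤ (ν.prod Q) ((univ ×ˢ Tinf) ∪ G') := measure_mono hincl
    _ = 0 := hnull

end Summit.AtomisticToContinuum.Crystallization.Theorems.MinimisingLawsHaveAtoms.Negative.DilatedLawDiffuse

end
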